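import Summits.AtomisticToContinuum.HydrodynamicLimit.Theorems.RelayRaceLocalityLightConeInLawSketchLine

/-!
# Restatement menu for the crux `LightConeInLaw` (stmt-AtomisticToContinuum-12500) — EVIDENCE ONLY

Line lead c2 (prover-line-stmt-AtomisticToContinuum-12500-c2-0), attached with `Lines/Sketch.dead.md`.
Not a proposal: the two `def … : Prop` below are CANDIDATE restatements for the PLANNER (D-0019: only a
planner files or reshapes statement items), typed and kernel-checked here so that a `route edit` can
adopt one verbatim; the two theorems record how they relate to the crux as filed.

* `LightConeInLawCommensurate` (R2) — the crux with the comparison particle number PINNED to the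
  commensurate family `n₂ N = ⌈(σ₂/σ₁)³ (N + 1)⌉₊` (instead of "any `n₂` with `n₂ ε_N³ → σ₂³`").
  This removes the gratuitous `o(N)`-slack that makes the crux imply ParticleNumberContinuity
  (`Necessary.particleNumberContinuity_of_lightConeInLaw`: with `R ≥ 1` the filed crux compares
  `N + 1` with `N + 1 + o(N)` spheres of the SAME global state — a statement of hydrodynamic-limit
  type with no locality content), while still serving the consumer `ConeLocalisation` (stmt-12504),
  whose comparison gas has `n₂ N = ⌈ρ(0,x₀)(N+1)⌉` spheres, i.e. `(σ₂/σ₁)³ = ρ(0,x₀)`.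
  `commensurate_of_lightConeInLaw : LightConeInLaw → LightConeInLawCommensurate`.
* `LightConeInLawCoupled` (R3) — the refuter's REPAIR (b) (route review rreview-0815T18-28, archive
  note 19844): the two-copy statement made CONDITIONAL on an exact local coupling — couplings `Q N` of
  the two laws under which the sets of phase points of the two configurations inside `B(x₀, R)`
  coincide with probability `→ 1`. Its content is then pure TRAJECTORY LOCALITY (two configurations
  agreeing in `B(x₀,R)` at time `0` have, with high probability, the same reduced fields in
  `B(x₀, R − c t)` at time `t`): no particle-number / law-stability residual. The burden moves to the
  glue (constructing such a coupling for a TUNED flattened comparison family — statics).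
  `coupled_of_lightConeInLaw : LightConeInLaw → LightConeInLawCoupled`.
* (R1) the ONE-FAMILY cone (`σ₂ = σ₁`, `n₂ N = N + 1`, same flows) is already in the tree as the
  conclusion of `Necessary.oneFamily_of_lightConeInLaw` (p103773); it is R2 at `σ₂ = σ₁` but does NOT
  serve `ConeLocalisation` as planned (the flattened comparison gas has a different total mass).

Ordering (all kernel-checked below): crux ⇒ R2 (`commensurate_of_lightConeInLaw`) ⇒ R1
(`oneFamily_of_commensurate`), and crux ⇒ R3 (`coupled_of_lightConeInLaw`).
None of R1–R3 is claimed provable: each still contains the light cone proper (the route's engine,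
M1/M2), which is harder than the open equilibrium rung `GibbsLightCone` (stmt-12501).
-/

namespace Summit.AtomisticToContinuum.HydrodynamicLimit.Cruxes.LightConeInLaw.Restatements

open scoped BigOperators Topology Classical ENNReal
open Filter Set MeasureTheory
open Literature.MathematicalPhysics.KineticTheory Literature.Analysis.FluidPDE
open Summit.AtomisticToContinuum.HydrodynamicLimit.Theorems.LightConeInLawSketch

noncomputable section

/-- (R2) **Commensurate two-copy light cone in law**: the crux `LightConeInLaw` verbatim except that
the comparison particle number is pinned, `∀ N, n₂ N = ⌈(σ₂/σ₁)³ (N+1)⌉₊`, in place of the filed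
`n₂ N · hsDiameter σ₁ N ^ 3 → σ₂³`. Candidate restatement (planner), not an item. -/
def LightConeInLawCommensurate : Prop :=
  ∃ η₀ : ℝ, 0 < η₀ ∧ ∀ M : ℝ, 0 < M → ∃ c : ℝ, 0 < c ∧ ∀ (a₁ θ₁ a₂ θ₂ : T3 → ℝ) (u₁ u₂ : T3 → V3),
    Continuous a₁ → Continuous θ₁ → Continuous u₁ → Continuous a₂ → Continuous θ₂ → Continuous u₂ →
    (∀ x, 0 < a₁ x) → (∀ x, 0 < θ₁ x) → (∀ x, 0 < a₂ x) → (∀ x, 0 < θ₂ x) → ∃ σ₀ : ℝ, 0 < σ₀ ∧ ∀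
    (σ₁ σ₂ : ℝ), 0 < σ₁ → σ₁ < σ₀ → 0 < σ₂ → σ₂ < σ₀ → ∀ n₂ : ℕ → ℕ, (∀ N, n₂ N = ⌈(σ₂ / σ₁) ^ 3 *
    ((N + 1 : ℕ) : ℝ)⌉₊) → ∀ (T₁ T₂ : ℝ) (ρ₁ Θ₁ ρ₂ Θ₂ : ℝ → T3 → ℝ) (U₁ U₂ : ℝ → T3 → V3),
    IsHardSphereEulerSolution σ₁ T₁ ρ₁ U₁ Θ₁ → IsHardSphereEulerSolution σ₂ T₂ ρ₂ U₂ Θ₂ → ∀ (Φ₁ :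
    (N : ℕ) → HardSphereFlow (Torus.geometry (Fin 3)) (hsDiameter σ₁ N) (N + 1)) (Φ₂ : (N : ℕ) →
    HardSphereFlow (Torus.geometry (Fin 3)) (hsDiameter σ₁ N) (n₂ N)),
    let P₁ : (N : ℕ) → Measure (Config (N + 1) (Fin 3) T3) := fun N => localGibbsLaw σ₁ a₁ u₁ θ₁ N (Φ₁ N);
    let P₂ : (N : ℕ) → Measure (Config (n₂ N) (Fin 3) T3) := fun N => particleLaw (Φ₂ N) (canonicalDensity (Torus.geometry (Fin 3)) (hsDiameter σ₁ N) (n₂ N) (localGibbsProfile a₂ u₂ θ₂));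
    (∀ N, IsProbabilityMeasure (P₁ N)) → (∀ N, IsProbabilityMeasure (P₂ N)) → TendstoHydroFieldsAt
    P₁ Φ₁ ρ₁ U₁ Θ₁ 0 → (∀ χ : T3 → ℝ, Continuous χ → ∀ δ : ℝ, 0 < δ → Tendsto (fun N => P₂ N {z | δ
    < |empiricalDensityField ((Φ₂ N).flow 0 z) χ - ∫ x, χ x * ρ₂ 0 x|}) atTop (nhds 0) ∧ Tendsto
    (fun N => P₂ N {z | δ < ‖empiricalMomentumField ((Φ₂ N).flow 0 z) χ - ∫ x, (χ x * ρ₂ 0 x) • U₂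
    0 x‖}) atTop (nhds 0) ∧ Tendsto (fun N => P₂ N {z | δ < |empiricalEnergyField ((Φ₂ N).flow 0 z)
    χ - ∫ x, χ x * totalEnergyDensity (ρ₂ 0 x) (U₂ 0 x) (Θ₂ 0 x)|}) atTop (nhds 0)) → ∀ t : ℝ, 0 ≤
    t → t < T₁ → t < T₂ → (∀ s ∈ Set.Icc 0 t, ∀ x, ρ₁ s x * σ₁ ^ 3 < η₀ ∧ Θ₁ s x ≤ M ∧ ‖U₁ s x‖ ≤ M
    ∧ ρ₂ s x * σ₂ ^ 3 < η₀ ∧ Θ₂ s x ≤ M ∧ ‖U₂ s x‖ ≤ M) → ∀ (x₀ : T3) (R : ℝ), (∀ x,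
    Torus.euclidDist x x₀ < R → ρ₁ 0 x * σ₁ ^ 3 = ρ₂ 0 x * σ₂ ^ 3 ∧ U₁ 0 x = U₂ 0 x ∧ Θ₁ 0 x = Θ₂ 0
    x) → ∀ χ : T3 → ℝ, Continuous χ → (∀ x, R - c * t ≤ Torus.euclidDist x x₀ → χ x = 0) → ∀ F : ℝ
    × V3 × ℝ → ℝ, LipschitzWith 1 F → (∀ p, |F p| ≤ 1) → Tendsto (fun N => (∫ z, F (σ₁ ^ 3 *
    empiricalDensityField ((Φ₁ N).flow t z) χ, (σ₁ ^ 3) • empiricalMomentumField ((Φ₁ N).flow t z)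
    χ, σ₁ ^ 3 * empiricalEnergyField ((Φ₁ N).flow t z) χ) ∂(P₁ N)) - ∫ z, F (σ₂ ^ 3 *
    empiricalDensityField ((Φ₂ N).flow t z) χ, (σ₂ ^ 3) • empiricalMomentumField ((Φ₂ N).flow t z)
    χ, σ₂ ^ 3 * empiricalEnergyField ((Φ₂ N).flow t z) χ) ∂(P₂ N)) atTop (nhds 0)

/-- (R3) **Two-copy light cone in law under an exact local coupling** (refuter REPAIR (b)): the crux
verbatim with one more hypothesis after the agreement clause — a family of couplings `Q N` of
`(P₁ N, P₂ N)` under which the phase points of the two configurations inside `B(x₀, R)` coincide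
(as subsets of `𝕋³ × ℝ³`) with probability tending to `1`. Candidate restatement, not an item. -/
def LightConeInLawCoupled : Prop :=
  ∃ η₀ : ℝ, 0 < η₀ ∧ ∀ M : ℝ, 0 < M → ∃ c : ℝ, 0 < c ∧ ∀ (a₁ θ₁ a₂ θ₂ : T3 → ℝ) (u₁ u₂ : T3 → V3),
    Continuous a₁ → Continuous θ₁ → Continuous u₁ → Continuous a₂ → Continuous θ₂ → Continuous u₂ →
    (∀ x, 0 < a₁ x) → (∀ x, 0 < θ₁ x) → (∀ x, 0 < a₂ x) → (∀ x, 0 < θ₂ x) → ∃ σ₀ : ℝ, 0 < σ₀ ∧ ∀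
    (σ₁ σ₂ : ℝ), 0 < σ₁ → σ₁ < σ₀ → 0 < σ₂ → σ₂ < σ₀ → ∀ n₂ : ℕ → ℕ, Tendsto (fun N => (n₂ N : ℝ) *
    hsDiameter σ₁ N ^ 3) atTop (nhds (σ₂ ^ 3)) → ∀ (T₁ T₂ : ℝ) (ρ₁ Θ₁ ρ₂ Θ₂ : ℝ → T3 → ℝ) (U₁ U₂ :
    ℝ → T3 → V3), IsHardSphereEulerSolution σ₁ T₁ ρ₁ U₁ Θ₁ → IsHardSphereEulerSolution σ₂ T₂ ρ₂ U₂
    Θ₂ → ∀ (Φ₁ : (N : ℕ) → HardSphereFlow (Torus.geometry (Fin 3)) (hsDiameter σ₁ N) (N + 1)) (Φ₂ :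
    (N : ℕ) → HardSphereFlow (Torus.geometry (Fin 3)) (hsDiameter σ₁ N) (n₂ N)),
    let P₁ : (N : ℕ) → Measure (Config (N + 1) (Fin 3) T3) := fun N => localGibbsLaw σ₁ a₁ u₁ θ₁ N (Φ₁ N);
    let P₂ : (N : ℕ) → Measure (Config (n₂ N) (Fin 3) T3) := fun N => particleLaw (Φ₂ N) (canonicalDensity (Torus.geometry (Fin 3)) (hsDiameter σ₁ N) (n₂ N) (localGibbsProfile a₂ u₂ θ₂));
    (∀ N, IsProbabilityMeasure (P₁ N)) → (∀ N, IsProbabilityMeasure (P₂ N)) → TendstoHydroFieldsAt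
    P₁ Φ₁ ρ₁ U₁ Θ₁ 0 → (∀ χ : T3 → ℝ, Continuous χ → ∀ δ : ℝ, 0 < δ → Tendsto (fun N => P₂ N {z | δ
    < |empiricalDensityField ((Φ₂ N).flow 0 z) χ - ∫ x, χ x * ρ₂ 0 x|}) atTop (nhds 0) ∧ Tendsto
    (fun N => P₂ N {z | δ < ‖empiricalMomentumField ((Φ₂ N).flow 0 z) χ - ∫ x, (χ x * ρ₂ 0 x) • U₂
    0 x‖}) atTop (nhds 0) ∧ Tendsto (fun N => P₂ N {z | δ < |empiricalEnergyField ((Φ₂ N).flow 0 z)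
    χ - ∫ x, χ x * totalEnergyDensity (ρ₂ 0 x) (U₂ 0 x) (Θ₂ 0 x)|}) atTop (nhds 0)) → ∀ t : ℝ, 0 ≤
    t → t < T₁ → t < T₂ → (∀ s ∈ Set.Icc 0 t, ∀ x, ρ₁ s x * σ₁ ^ 3 < η₀ ∧ Θ₁ s x ≤ M ∧ ‖U₁ s x‖ ≤ M
    ∧ ρ₂ s x * σ₂ ^ 3 < η₀ ∧ Θ₂ s x ≤ M ∧ ‖U₂ s x‖ ≤ M) → ∀ (x₀ : T3) (R : ℝ), (∀ x,
    Torus.euclidDist x x₀ < R → ρ₁ 0 x * σ₁ ^ 3 = ρ₂ 0 x * σ₂ ^ 3 ∧ U₁ 0 x = U₂ 0 x ∧ Θ₁ 0 x = Θ₂ 0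
    x) → ∀ Q : (N : ℕ) → Measure (Config (N + 1) (Fin 3) T3 × Config (n₂ N) (Fin 3) T3), (∀ N, (Q
    N).map Prod.fst = P₁ N) → (∀ N, (Q N).map Prod.snd = P₂ N) → Tendsto (fun N => Q N {p | {q : T3
    × V3 | ∃ i, p.1 i = q ∧ Torus.euclidDist q.1 x₀ < R} ≠ {q : T3 × V3 | ∃ i, p.2 i = q ∧
    Torus.euclidDist q.1 x₀ < R}}) atTop (nhds 0) → ∀ χ : T3 → ℝ, Continuous χ → (∀ x, R - c * t ≤
    Torus.euclidDist x x₀ → χ x = 0) → ∀ F : ℝ × V3 × ℝ → ℝ, LipschitzWith 1 F → (∀ p, |F p| ≤ 1) →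
    Tendsto (fun N => (∫ z, F (σ₁ ^ 3 * empiricalDensityField ((Φ₁ N).flow t z) χ, (σ₁ ^ 3) •
    empiricalMomentumField ((Φ₁ N).flow t z) χ, σ₁ ^ 3 * empiricalEnergyField ((Φ₁ N).flow t z) χ)
    ∂(P₁ N)) - ∫ z, F (σ₂ ^ 3 * empiricalDensityField ((Φ₂ N).flow t z) χ, (σ₂ ^ 3) •
    empiricalMomentumField ((Φ₂ N).flow t z) χ, σ₂ ^ 3 * empiricalEnergyField ((Φ₂ N).flow t z) χ)
    ∂(P₂ N)) atTop (nhds 0)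

/-! ## Relations to the crux as filed -/

/-- `hsDiameter σ N ^ 3 = σ³ / (N + 1)` (from `succ_mul_hsDiameter_pow_three`). -/
theorem hsDiameter_pow_three_eq (σ : ℝ) (N : ℕ) :
    hsDiameter σ N ^ 3 = σ ^ 3 / ((N + 1 : ℕ) : ℝ) := by
  have h1 := succ_mul_hsDiameter_pow_three σ N
  have hN : (0 : ℝ) < ((N + 1 : ℕ) : ℝ) := by positivity
  rw [eq_div_iff hN.ne', mul_comm]
  exact h1

/-- The pinned commensurate family satisfies the filed asymptotic condition:
`⌈(σ₂/σ₁)³ (N+1)⌉₊ · hsDiameter σ₁ N ^ 3 → σ₂³` (squeeze between `q σ₁³` and `q σ₁³ + σ₁³/(N+1)`,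
`q = (σ₂/σ₁)³`). -/
theorem tendsto_ceil_mul_hsDiameter {σ₁ σ₂ : ℝ} (hσ₁ : 0 < σ₁) (hσ₂ : 0 < σ₂) {n₂ : ℕ → ℕ}
    (hn : ∀ N, n₂ N = ⌈(σ₂ / σ₁) ^ 3 * ((N + 1 : ℕ) : ℝ)⌉₊) :
    Tendsto (fun N => (n₂ N : ℝ) * hsDiameter σ₁ N ^ 3) atTop (𝓝 (σ₂ ^ 3)) := by
  set q : ℝ := (σ₂ / σ₁) ^ 3 with hq
  have hq0 : 0 ≤ q := by positivity
  have hσ₁3 : σ₁ ^ 3 ≠ 0 := by positivity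
  have hqσ : q * σ₁ ^ 3 = σ₂ ^ 3 := by
    rw [hq, div_pow, div_mul_cancel₀ _ hσ₁3]
  have hlow : ∀ N, q * σ₁ ^ 3 ≤ (n₂ N : ℝ) * hsDiameter σ₁ N ^ 3 := by
    intro N
    have hN : (0 : ℝ) < ((N + 1 : ℕ) : ℝ) := by positivity
    rw [hn N, hsDiameter_pow_three_eq]
    calc q * σ₁ ^ 3 = (q * ((N + 1 : ℕ) : ℝ)) * (σ₁ ^ 3 / ((N + 1 : ℕ) : ℝ)) := by
          field_simp
      _ ≤ (⌈q * ((N + 1 : ℕ) : ℝ)⌉₊ : ℝ) * (σ₁ ^ 3 / ((N + 1 : ℕ) : ℝ)) := by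
          gcongr
          exact Nat.le_ceil _
  have hup : ∀ N, (n₂ N : ℝ) * hsDiameter σ₁ N ^ 3 ≤ q * σ₁ ^ 3 + σ₁ ^ 3 / ((N + 1 : ℕ) : ℝ) := by
    intro N
    have hN : (0 : ℝ) < ((N + 1 : ℕ) : ℝ) := by positivity
    rw [hn N, hsDiameter_pow_three_eq]
    have h2 : (⌈q * ((N + 1 : ℕ) : ℝ)⌉₊ : ℝ) < q * ((N + 1 : ℕ) : ℝ) + 1 :=
      Nat.ceil_lt_add_one (by positivity)
    calc (⌈q * ((N + 1 : ℕ) : ℝ)⌉₊ : ℝ) * (σ₁ ^ 3 / ((N + 1 : ℕ) : ℝ))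
        ≤ (q * ((N + 1 : ℕ) : ℝ) + 1) * (σ₁ ^ 3 / ((N + 1 : ℕ) : ℝ)) := by gcongr
      _ = q * σ₁ ^ 3 + σ₁ ^ 3 / ((N + 1 : ℕ) : ℝ) := by field_simp
  have hlim : Tendsto (fun N : ℕ => q * σ₁ ^ 3 + σ₁ ^ 3 / ((N + 1 : ℕ) : ℝ)) atTop
      (𝓝 (q * σ₁ ^ 3)) := by
    have h0 : Tendsto (fun N : ℕ => σ₁ ^ 3 / ((N + 1 : ℕ) : ℝ)) atTop (𝓝 0) :=
      (tendsto_const_div_atTop_nhds_zero_nat (σ₁ ^ 3)).comp (tendsto_add_atTop_nat 1)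
    simpa using tendsto_const_nhds.add h0
  rw [← hqσ]
  exact tendsto_of_tendsto_of_tendsto_of_le_of_le tendsto_const_nhds hlim hlow hup

/-- **crux ⇒ (R2).** The filed crux implies its commensurate restatement (the pinned family
satisfies the filed asymptotic condition, `tendsto_ceil_mul_hsDiameter`). -/
theorem commensurate_of_lightConeInLaw :
    Summit.AtomisticToContinuum.HydrodynamicLimit.Theses.RelayRaceLocality.LightConeInLaw →
    LightConeInLawCommensurate := by
  intro h
  obtain ⟨η₀, hη₀, H⟩ := h
  refine ⟨η₀, hη₀, fun M hM => ?_⟩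
  obtain ⟨c, hc, Hc⟩ := H M hM
  refine ⟨c, hc, ?_⟩
  intro a₁ θ₁ a₂ θ₂ u₁ u₂ ha₁ hθ₁ hu₁ ha₂ hθ₂ hu₂ ha₁0 hθ₁0 ha₂0 hθ₂0
  obtain ⟨σ₀, hσ₀, Hσ⟩ := Hc a₁ θ₁ a₂ θ₂ u₁ u₂ ha₁ hθ₁ hu₁ ha₂ hθ₂ hu₂ ha₁0 hθ₁0 ha₂0 hθ₂0
  refine ⟨σ₀, hσ₀, ?_⟩
  intro σ₁ σ₂ hσ₁ hσ₁' hσ₂ hσ₂' n₂ hn₂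
  exact Hσ σ₁ σ₂ hσ₁ hσ₁' hσ₂ hσ₂' n₂ (tendsto_ceil_mul_hsDiameter hσ₁ hσ₂ hn₂)

/-- **crux ⇒ (R3).** The filed crux implies its exact-local-coupling restatement (the coupling
hypotheses are not used). -/
theorem coupled_of_lightConeInLaw :
    Summit.AtomisticToContinuum.HydrodynamicLimit.Theses.RelayRaceLocality.LightConeInLaw →
    LightConeInLawCoupled := by
  intro h
  obtain ⟨η₀, hη₀, H⟩ := h
  refine ⟨η₀, hη₀, fun M hM => ?_⟩
  obtain ⟨c, hc, Hc⟩ := H M hM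
  refine ⟨c, hc, ?_⟩
  intro a₁ θ₁ a₂ θ₂ u₁ u₂ ha₁ hθ₁ hu₁ ha₂ hθ₂ hu₂ ha₁0 hθ₁0 ha₂0 hθ₂0
  obtain ⟨σ₀, hσ₀, Hσ⟩ := Hc a₁ θ₁ a₂ θ₂ u₁ u₂ ha₁ hθ₁ hu₁ ha₂ hθ₂ hu₂ ha₁0 hθ₁0 ha₂0 hθ₂0
  refine ⟨σ₀, hσ₀, ?_⟩
  intro σ₁ σ₂ hσ₁ hσ₁' hσ₂ hσ₂' n₂ hn₂ T₁ T₂ ρ₁ Θ₁ ρ₂ Θ₂ U₁ U₂ hsol₁ hsol₂ Φ₁ Φ₂ P₁ P₂ hP₁ hP₂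
    hL₁ hL₂ t ht htT₁ htT₂ hguard x₀ R hagree _Q _hQ₁ _hQ₂ _hQ χ hχ hsupp F hF hFb
  exact Hσ σ₁ σ₂ hσ₁ hσ₁' hσ₂ hσ₂' n₂ hn₂ T₁ T₂ ρ₁ Θ₁ ρ₂ Θ₂ U₁ U₂ hsol₁ hsol₂ Φ₁ Φ₂ hP₁ hP₂ hL₁
    hL₂ t ht htT₁ htT₂ hguard x₀ R hagree χ hχ hsupp F hF hFb

/-- **(R2) ⇒ (R1).** The commensurate restatement implies the one-family cone (the conclusion of
`Necessary.oneFamily_of_lightConeInLaw`, verbatim): take `σ₂ := σ₁ := σ`, `n₂ N := N + 1`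
(`⌈(σ/σ)³ (N+1)⌉₊ = N + 1`), `Φ₂ := Φ₁ := Φ`; the comparison law is then `localGibbsLaw σ a₂ u₂ θ₂ N (Φ N)`
definitionally. So the menu is totally ordered under the crux: crux ⇒ R2 ⇒ R1. -/
theorem oneFamily_of_commensurate :
    LightConeInLawCommensurate →
    ∃ η₀ : ℝ, 0 < η₀ ∧ ∀ M : ℝ, 0 < M → ∃ c : ℝ, 0 < c ∧
    ∀ (a₁ θ₁ a₂ θ₂ : T3 → ℝ) (u₁ u₂ : T3 → V3), Continuous a₁ → Continuous θ₁ → Continuous u₁ →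
      Continuous a₂ → Continuous θ₂ → Continuous u₂ → (∀ x, 0 < a₁ x) → (∀ x, 0 < θ₁ x) →
      (∀ x, 0 < a₂ x) → (∀ x, 0 < θ₂ x) →
    ∃ σ₀ : ℝ, 0 < σ₀ ∧ ∀ σ : ℝ, 0 < σ → σ < σ₀ →
    ∀ (T₁ T₂ : ℝ) (ρ₁ Θ₁ ρ₂ Θ₂ : ℝ → T3 → ℝ) (U₁ U₂ : ℝ → T3 → V3),
      IsHardSphereEulerSolution σ T₁ ρ₁ U₁ Θ₁ → IsHardSphereEulerSolution σ T₂ ρ₂ U₂ Θ₂ →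
    ∀ Φ : (N : ℕ) → HardSphereFlow G3 (hsDiameter σ N) (N + 1),
    (∀ N, IsProbabilityMeasure (localGibbsLaw σ a₁ u₁ θ₁ N (Φ N))) →
    (∀ N, IsProbabilityMeasure (localGibbsLaw σ a₂ u₂ θ₂ N (Φ N))) →
    TendstoHydroFieldsAt (fun N => localGibbsLaw σ a₁ u₁ θ₁ N (Φ N)) Φ ρ₁ U₁ Θ₁ 0 →
    TendstoHydroFieldsAt (fun N => localGibbsLaw σ a₂ u₂ θ₂ N (Φ N)) Φ ρ₂ U₂ Θ₂ 0 →
    ∀ t : ℝ, 0 ≤ t → t < T₁ → t < T₂ →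
      (∀ s ∈ Set.Icc 0 t, ∀ x, ρ₁ s x * σ ^ 3 < η₀ ∧ Θ₁ s x ≤ M ∧ ‖U₁ s x‖ ≤ M ∧
        ρ₂ s x * σ ^ 3 < η₀ ∧ Θ₂ s x ≤ M ∧ ‖U₂ s x‖ ≤ M) →
    ∀ (x₀ : T3) (R : ℝ),
      (∀ x, Torus.euclidDist x x₀ < R → ρ₁ 0 x = ρ₂ 0 x ∧ U₁ 0 x = U₂ 0 x ∧ Θ₁ 0 x = Θ₂ 0 x) →
    ∀ χ : T3 → ℝ, Continuous χ → (∀ x, R - c * t ≤ Torus.euclidDist x x₀ → χ x = 0) →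
    ∀ F : ℝ × V3 × ℝ → ℝ, LipschitzWith 1 F → (∀ p, |F p| ≤ 1) →
      Tendsto (fun N =>
        (∫ z, F (σ ^ 3 * empiricalDensityField ((Φ N).flow t z) χ,
            (σ ^ 3) • empiricalMomentumField ((Φ N).flow t z) χ,
            σ ^ 3 * empiricalEnergyField ((Φ N).flow t z) χ) ∂(localGibbsLaw σ a₁ u₁ θ₁ N (Φ N))) -
        ∫ z, F (σ ^ 3 * empiricalDensityField ((Φ N).flow t z) χ,
            (σ ^ 3) • empiricalMomentumField ((Φ N).flow t z) χ,
            σ ^ 3 * empiricalEnergyField ((Φ N).flow t z) χ) ∂(localGibbsLaw σ a₂ u₂ θ₂ N (Φ N)))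
        atTop (𝓝 0) := by
  intro h
  obtain ⟨η₀, hη₀, H⟩ := h
  refine ⟨η₀, hη₀, fun M hM => ?_⟩
  obtain ⟨c, hc, Hc⟩ := H M hM
  refine ⟨c, hc, ?_⟩
  intro a₁ θ₁ a₂ θ₂ u₁ u₂ ha₁ hθ₁ hu₁ ha₂ hθ₂ hu₂ ha₁0 hθ₁0 ha₂0 hθ₂0
  obtain ⟨σ₀, hσ₀, Hσ⟩ := Hc a₁ θ₁ a₂ θ₂ u₁ u₂ ha₁ hθ₁ hu₁ ha₂ hθ₂ hu₂ ha₁0 hθ₁0 ha₂0 hθ₂0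
  refine ⟨σ₀, hσ₀, ?_⟩
  intro σ hσ hσlt T₁ T₂ ρ₁ Θ₁ ρ₂ Θ₂ U₁ U₂ hsol₁ hsol₂ Φ hP₁ hP₂ hL₁ hL₂ t ht htT₁ htT₂ hguard x₀ R
    hagree χ hχ hsupp F hF hFb
  have hn : ∀ N : ℕ, N + 1 = ⌈(σ / σ) ^ 3 * ((N + 1 : ℕ) : ℝ)⌉₊ := fun N => by
    rw [div_self hσ.ne', one_pow, one_mul, Nat.ceil_natCast]
  have hagree' : ∀ x, Torus.euclidDist x x₀ < R →
      ρ₁ 0 x * σ ^ 3 = ρ₂ 0 x * σ ^ 3 ∧ U₁ 0 x = U₂ 0 x ∧ Θ₁ 0 x = Θ₂ 0 x := fun x hx => by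
    obtain ⟨h1, h2, h3⟩ := hagree x hx
    exact ⟨by rw [h1], h2, h3⟩
  exact Hσ σ σ hσ hσlt hσ hσlt (fun N => N + 1) hn T₁ T₂ ρ₁ Θ₁ ρ₂ Θ₂ U₁ U₂ hsol₁ hsol₂ Φ Φ
    hP₁ hP₂ hL₁ hL₂ t ht htT₁ htT₂ hguard x₀ R hagree' χ hχ hsupp F hF hFb

end

end Summit.AtomisticToContinuum.HydrodynamicLimit.Cruxes.LightConeInLaw.Restatements
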